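import Mathlib
import Summits.ValiantsHypothesis.ValiantsHypothesis.Theorems.RigidityForcesSymmetryRankRigidMinimalReprLaplaceFourDefs
import Summits.ValiantsHypothesis.ValiantsHypothesis.Theorems.RigidityForcesSymmetryRankRigidMinimalReprLaplaceFourContraction
import Summits.ValiantsHypothesis.ValiantsHypothesis.Theorems.RigidityForcesSymmetryRankRigidMinimalReprLaplaceFourGeneric
import Summits.ValiantsHypothesis.ValiantsHypothesis.Theorems.RigidityForcesSymmetryRankRigidMinimalReprLaplaceFourBlock

/-!
# The profile `(2,2,1)`: the column pattern forced by an EA-typed `𝒢` (the «S9 lemma»)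
# (crux `RankRigidMinimalRepr`, stmt-ValiantsHypothesis-18034, route `RigidityForcesSymmetry`)

For `P₄ = Σ_{t<2} g_t(v₀,v₁)h_t(v₂,v₃) + Σ_{k<2} b_k(v₀,v₂)b′_k(v₁,v₃) + c(v₀,v₃)c′(v₁,v₂)` with `g_t ∈ span{E^{01}, A_{23}}`
(`t = 0,1`): the kernel plane `K_φ ∋ ψ_A = (0,0,φ₂,φ₃), ψ_B = (φ₀,-φ₁,2φ₂,2φ₃)`, where `Q(ψ,φ) = R(ψ,φ)` is a sum of three
rank-one matrices of rank exactly `3` (explicit minors `4φ₀φ₁φ₂²φ₃²`, `24φ₀φ₁φ₂²φ₃²`) annihilated by `n_φ = (0,0,φ₂,-φ₃)` on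
both sides.  Hence (`rank3_extract`) the row and column vectors of `R` are orthogonal to `n_φ`; as polynomial identities
in `φ` (covering lemma) these say (`columns23_of_EA`): for each of `b_k, b′_k, c, c′`, column `2` is `τ e₃` and column `3`
is `τ e₂` (the same `τ`).

HONEST FRAMING: a step toward `LaplaceOptimal 4` (rung `TiedTorusBound 3`); the crux stays OPEN; nothing on `VP ≠ VNP`.
-/

set_option autoImplicit false

-- the mandated summit-side namespace repeats a component by design (single-problem summit)
set_option linter.dupNamespace false

namespace Summit.ValiantsHypothesis.ValiantsHypothesis.Theorems.RigidityForcesSymmetryRankRigidMinimalRepr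

namespace LaplaceFourLine

open Matrix LaplaceFourContraction LaplaceFourGeneric

/-! ### §1 Rank-three extraction -/

/-- If `M = Σ_{k<3} x_k y_kᵀ` has a non-zero `3 × 3` minor (rows `r`, columns `s`) and `M n = 0`, `mᵀ M = 0`, then every
`y_k ⊥ n` and every `x_k ⊥ m`. -/
theorem rank3_extract (x y : Fin 3 → Fin 4 → ℂ) (n m : Fin 4 → ℂ) (r s : Fin 3 → Fin 4)
    (hdet : (Matrix.of fun i j : Fin 3 => ∑ k : Fin 3, x k (r i) * y k (s j)).det ≠ 0)
    (hMn : ∀ i : Fin 4, (∑ j, (∑ k : Fin 3, x k i * y k j) * n j) = 0)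
    (hmM : ∀ j : Fin 4, (∑ i, m i * ∑ k : Fin 3, x k i * y k j) = 0) :
    (∀ k, (∑ j, y k j * n j) = 0) ∧ (∀ k, (∑ i, m i * x k i) = 0) := by
  let X : Matrix (Fin 3) (Fin 3) ℂ := Matrix.of fun i k => x k (r i)
  let Y : Matrix (Fin 3) (Fin 3) ℂ := Matrix.of fun j k => y k (s j)
  have hXY : X * Yᵀ = Matrix.of fun i j : Fin 3 => ∑ k : Fin 3, x k (r i) * y k (s j) := by
    ext i j; simp [X, Y, Matrix.mul_apply]
  have hX : X.det ≠ 0 := fun h0 => hdet (by rw [← hXY, Matrix.det_mul, h0, zero_mul])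
  have hY : Y.det ≠ 0 := fun h0 => hdet (by rw [← hXY, Matrix.det_mul, Matrix.det_transpose, h0, mul_zero])
  constructor
  · have hv : X *ᵥ (fun k => ∑ j, y k j * n j) = 0 := by
      ext i
      have := hMn (r i)
      simp only [Matrix.mulVec, dotProduct, X, Matrix.of_apply, Pi.zero_apply]
      rw [← this]
      simp only [Finset.sum_mul, Finset.mul_sum]
      rw [Finset.sum_comm]
      exact Finset.sum_congr rfl fun k _ => Finset.sum_congr rfl fun j _ => by ring
    have := Matrix.eq_zero_of_mulVec_eq_zero hX hv
    exact fun k => congrFun this k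
  · have hv : Y *ᵥ (fun k => ∑ i, m i * x k i) = 0 := by
      ext j
      have := hmM (s j)
      simp only [Matrix.mulVec, dotProduct, Y, Matrix.of_apply, Pi.zero_apply]
      rw [← this]
      simp only [Finset.mul_sum]
      rw [Finset.sum_comm]
      exact Finset.sum_congr rfl fun k _ => Finset.sum_congr rfl fun j _ => by ring
    have := Matrix.eq_zero_of_mulVec_eq_zero hY hv
    exact fun k => congrFun this k

/-! ### §2 Quadratic forms vanishing on the torus -/

/-- A quadratic form vanishing on `(ℂˣ)⁴` vanishes identically: its symmetrised coefficients are zero. -/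
theorem quadForm_zero (a : Fin 4 → Fin 4 → ℂ)
    (h : ∀ φ : Fin 4 → ℂ, (∀ i, φ i ≠ 0) → (∑ i, ∑ j, a i j * φ i * φ j) = 0) : ∀ i j, a i j + a j i = 0 := by
  classical
  obtain ⟨-, hp⟩ := covering (ι := Unit) (κ := Unit)
    (fun _ _ => ∑ i, ∑ j, MvPolynomial.C (a i j) * MvPolynomial.X i * MvPolynomial.X j) (fun φ hφ => ⟨(), fun _ => by
      simp only [map_sum, map_mul, MvPolynomial.eval_C, MvPolynomial.eval_X]; exact h φ hφ⟩)
  have hid : ∀ φ : Fin 4 → ℂ, (∑ i, ∑ j, a i j * φ i * φ j) = 0 := by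
    intro φ
    have := congrArg (MvPolynomial.eval φ) (hp ())
    simpa only [map_sum, map_mul, MvPolynomial.eval_C, MvPolynomial.eval_X, map_zero] using this
  intro i j
  have h1 := hid (Pi.single i 1)
  have h2 := hid (Pi.single j 1)
  have h3 := hid (Pi.single i 1 + Pi.single j 1)
  fin_cases i <;> fin_cases j <;> simp only [Fin.zero_eta, Fin.mk_one, Fin.reduceFinMk, Fin.isValue] at h1 h2 h3 ⊢ <;>
    simp [Fin.sum_univ_four, Pi.single_apply] at h1 h2 h3 <;>
    first | (linear_combination 2 * h1) | (linear_combination h3 - h1 - h2)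

/-- The `φ`-type identity `φ₂(Mᵀφ)₂ = φ₃(Mᵀφ)₃` on the torus pins the columns `2, 3` of `M`. -/
theorem cols_of_phi_identity (M : Fin 4 → Fin 4 → ℂ)
    (h : ∀ φ : Fin 4 → ℂ, (∀ i, φ i ≠ 0) → φ 2 * (∑ w, φ w * M w 2) - φ 3 * (∑ w, φ w * M w 3) = 0) :
    M 0 2 = 0 ∧ M 1 2 = 0 ∧ M 2 2 = 0 ∧ M 0 3 = 0 ∧ M 1 3 = 0 ∧ M 3 3 = 0 ∧ M 3 2 = M 2 3 := by
  have hq := quadForm_zero ![![0, 0, 0, 0], ![0, 0, 0, 0], ![M 0 2, M 1 2, M 2 2, M 3 2],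
    ![-M 0 3, -M 1 3, -M 2 3, -M 3 3]] (fun φ hφ => by
      have := h φ hφ; simp only [Fin.sum_univ_four] at this; simp [Fin.sum_univ_four]; linear_combination this)
  have e20 := hq 2 0; have e21 := hq 2 1; have e22 := hq 2 2; have e23 := hq 2 3
  have e30 := hq 3 0; have e31 := hq 3 1; have e33 := hq 3 3
  simp only [Matrix.cons_val_zero, Matrix.cons_val_one, Matrix.head_cons, Matrix.cons_val_two, Matrix.tail_cons,
    Matrix.cons_val_three] at e20 e21 e22 e23 e30 e31 e33
  exact ⟨by linear_combination e20, by linear_combination e21, by linear_combination e22 / 2,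
    by linear_combination -e30, by linear_combination -e31, by linear_combination -e33 / 2, by linear_combination e23⟩

/-- The `ψ`-type identities (at `ψ_A` and `ψ_B`) `φ₂(Mᵀψ)₂ = φ₃(Mᵀψ)₃` on the torus pin the columns `2, 3` of `M`. -/
theorem cols_of_psi_identity (M : Fin 4 → Fin 4 → ℂ)
    (hA : ∀ φ : Fin 4 → ℂ, (∀ i, φ i ≠ 0) →
      φ 2 * (φ 2 * M 2 2 + φ 3 * M 3 2) - φ 3 * (φ 2 * M 2 3 + φ 3 * M 3 3) = 0)
    (hB : ∀ φ : Fin 4 → ℂ, (∀ i, φ i ≠ 0) →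
      φ 2 * (φ 0 * M 0 2 - φ 1 * M 1 2 + 2 * φ 2 * M 2 2 + 2 * φ 3 * M 3 2) -
        φ 3 * (φ 0 * M 0 3 - φ 1 * M 1 3 + 2 * φ 2 * M 2 3 + 2 * φ 3 * M 3 3) = 0) :
    M 0 2 = 0 ∧ M 1 2 = 0 ∧ M 2 2 = 0 ∧ M 0 3 = 0 ∧ M 1 3 = 0 ∧ M 3 3 = 0 ∧ M 3 2 = M 2 3 := by
  have hqA := quadForm_zero ![![0, 0, 0, 0], ![0, 0, 0, 0], ![0, 0, M 2 2, M 3 2], ![0, 0, -M 2 3, -M 3 3]]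
    (fun φ hφ => by have := hA φ hφ; simp [Fin.sum_univ_four]; linear_combination this)
  have hqB := quadForm_zero ![![0, 0, M 0 2, -M 0 3], ![0, 0, -M 1 2, M 1 3], ![0, 0, 2 * M 2 2, 2 * M 3 2],
    ![0, 0, -(2 * M 2 3), -(2 * M 3 3)]] (fun φ hφ => by have := hB φ hφ; simp [Fin.sum_univ_four]; linear_combination this)
  have a22 := hqA 2 2; have a23 := hqA 2 3; have a33 := hqA 3 3
  have b02 := hqB 0 2; have b03 := hqB 0 3; have b12 := hqB 1 2; have b13 := hqB 1 3
  simp only [Matrix.cons_val_zero, Matrix.cons_val_one, Matrix.head_cons, Matrix.cons_val_two, Matrix.tail_cons,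
    Matrix.cons_val_three] at a22 a23 a33 b02 b03 b12 b13
  exact ⟨by linear_combination b02, by linear_combination -b12, by linear_combination a22 / 2,
    by linear_combination -b03, by linear_combination b13, by linear_combination -a33 / 2, by linear_combination a23⟩

/-! ### §3 The two test vectors of the kernel plane -/

/-- `Q(ψ_A, φ)` for `ψ_A = (0,0,φ₂,φ₃)`. -/
theorem Q_psiA (φ : Fin 4 → ℂ) : contract₀₁ permPattern₄ ![0, 0, φ 2, φ 3] φ =
    !![0, 2 * (φ 2 * φ 3), φ 1 * φ 3, φ 1 * φ 2; 2 * (φ 2 * φ 3), 0, φ 0 * φ 3, φ 0 * φ 2;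
       φ 1 * φ 3, φ 0 * φ 3, 0, 0; φ 1 * φ 2, φ 0 * φ 2, 0, 0] := by
  rw [contract_permPattern_entries]; ext i j; fin_cases i <;> fin_cases j <;> simp <;> ring

/-- `Q(ψ_B, φ)` for `ψ_B = (φ₀,-φ₁,2φ₂,2φ₃)`. -/
theorem Q_psiB (φ : Fin 4 → ℂ) : contract₀₁ permPattern₄ ![φ 0, -φ 1, 2 * φ 2, 2 * φ 3] φ =
    !![0, 4 * (φ 2 * φ 3), φ 1 * φ 3, φ 1 * φ 2; 4 * (φ 2 * φ 3), 0, 3 * (φ 0 * φ 3), 3 * (φ 0 * φ 2);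
       φ 1 * φ 3, 3 * (φ 0 * φ 3), 0, 0; φ 1 * φ 2, 3 * (φ 0 * φ 2), 0, 0] := by
  rw [contract_permPattern_entries]; ext i j; fin_cases i <;> fin_cases j <;> simp <;> ring

/-- The rank-three extraction applied to `Q(ψ,φ) = R(ψ,φ)` for a test vector `ψ` whose contraction is one of the two
explicit matrices above (`κ = 2` for `ψ_A`, `κ = 4` for `ψ_B`, `μ = 1, 3`): orthogonality of the six vectors to
`n_φ = (0,0,φ₂,-φ₃)`. -/
theorem orth_of_test_vector (φ : Fin 4 → ℂ) (hφ : ∀ i, φ i ≠ 0) (κ μ : ℂ) (hκ : κ ≠ 0) (hμ : μ ≠ 0)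
    (x y : Fin 3 → Fin 4 → ℂ)
    (hR : ∀ i j, (!![0, κ * (φ 2 * φ 3), φ 1 * φ 3, φ 1 * φ 2; κ * (φ 2 * φ 3), 0, μ * (φ 0 * φ 3), μ * (φ 0 * φ 2);
        φ 1 * φ 3, μ * (φ 0 * φ 3), 0, 0; φ 1 * φ 2, μ * (φ 0 * φ 2), 0, 0] : Matrix (Fin 4) (Fin 4) ℂ) i j =
        ∑ k : Fin 3, x k i * y k j) :
    (∀ k, φ 2 * y k 2 - φ 3 * y k 3 = 0) ∧ (∀ k, φ 2 * x k 2 - φ 3 * x k 3 = 0) := by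
  have h0 := hφ 0; have h1 := hφ 1; have h2 := hφ 2; have h3 := hφ 3
  have hR' : ∀ i j, (∑ k : Fin 3, x k i * y k j) =
      (!![0, κ * (φ 2 * φ 3), φ 1 * φ 3, φ 1 * φ 2; κ * (φ 2 * φ 3), 0, μ * (φ 0 * φ 3), μ * (φ 0 * φ 2);
        φ 1 * φ 3, μ * (φ 0 * φ 3), 0, 0; φ 1 * φ 2, μ * (φ 0 * φ 2), 0, 0] : Matrix (Fin 4) (Fin 4) ℂ) i j :=
    fun i j => (hR i j).symm
  obtain ⟨hy, hx⟩ := rank3_extract x y ![0, 0, φ 2, -φ 3] ![0, 0, φ 2, -φ 3] ![0, 1, 2] ![0, 1, 3] (by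
      have : (Matrix.of fun i j : Fin 3 => ∑ k : Fin 3, x k (![0, 1, 2] i) * y k (![0, 1, 3] j)) =
          !![0, κ * (φ 2 * φ 3), φ 1 * φ 2; κ * (φ 2 * φ 3), 0, μ * (φ 0 * φ 2); φ 1 * φ 3, μ * (φ 0 * φ 3), 0] := by
        ext i j; fin_cases i <;> fin_cases j <;> simp [hR']
      rw [this, Matrix.det_fin_three]
      simp
      have : κ * (φ 2 * φ 3) * (μ * (φ 0 * φ 2)) * (φ 1 * φ 3) + φ 1 * φ 2 * (κ * (φ 2 * φ 3)) * (μ * (φ 0 * φ 3)) =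
          (2 * κ * μ) * (φ 0 * φ 1 * φ 2 ^ 2 * φ 3 ^ 2) := by ring
      rw [this]
      exact mul_ne_zero (mul_ne_zero (mul_ne_zero two_ne_zero hκ) hμ)
        (mul_ne_zero (mul_ne_zero (mul_ne_zero h0 h1) (pow_ne_zero 2 h2)) (pow_ne_zero 2 h3)))
    (fun i => by fin_cases i <;> simp [Fin.sum_univ_four, hR'] <;> ring)
    (fun j => by fin_cases j <;> simp [Fin.sum_univ_four, hR'] <;> ring)
  exact ⟨fun k => by have := hy k; simp [Fin.sum_univ_four] at this; linear_combination this,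
    fun k => by have := hx k; simp [Fin.sum_univ_four] at this; linear_combination this⟩

/-- One run of the rank-three extraction: for a test vector `ψ ∈ K_φ` with explicit contraction, the six vectors
`B′_kφ, Cψ` (rows) and `B_kψ, C′φ` (columns) of `R(ψ,φ)` are orthogonal to `n_φ = (0,0,φ₂,-φ₃)`. -/
theorem orth_run (g h b b' : Fin 2 → Fin 4 → Fin 4 → ℂ) (c c' : Fin 4 → Fin 4 → ℂ)
    (hsum : ∀ v, permPattern₄ v = (∑ t, g t (v 0) (v 1) * h t (v 2) (v 3)) +
      (∑ k, b k (v 0) (v 2) * b' k (v 1) (v 3)) + c (v 0) (v 3) * c' (v 1) (v 2))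
    (φ ψ : Fin 4 → ℂ) (hφ : ∀ i, φ i ≠ 0) (κ μ : ℂ) (hκ : κ ≠ 0) (hμ : μ ≠ 0)
    (hQ : contract₀₁ permPattern₄ ψ φ = !![0, κ * (φ 2 * φ 3), φ 1 * φ 3, φ 1 * φ 2;
      κ * (φ 2 * φ 3), 0, μ * (φ 0 * φ 3), μ * (φ 0 * φ 2); φ 1 * φ 3, μ * (φ 0 * φ 3), 0, 0;
      φ 1 * φ 2, μ * (φ 0 * φ 2), 0, 0])
    (hker : ∀ t, (∑ i, ∑ j, ψ i * φ j * g t i j) = 0) :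
    (∀ k, φ 2 * (∑ w, φ w * b' k w 2) - φ 3 * (∑ w, φ w * b' k w 3) = 0) ∧
    (φ 2 * (∑ z, ψ z * c z 2) - φ 3 * (∑ z, ψ z * c z 3) = 0) ∧
    (∀ k, φ 2 * (∑ z, ψ z * b k z 2) - φ 3 * (∑ z, ψ z * b k z 3) = 0) ∧
    (φ 2 * (∑ w, φ w * c' w 2) - φ 3 * (∑ w, φ w * c' w 3) = 0) := by
  have hR := contract_eq_rank_three g h b b' c c' hsum ψ φ hker
  rw [hQ] at hR
  let x : Fin 3 → Fin 4 → ℂ := ![fun i => ∑ z, ψ z * b 0 z i, fun i => ∑ z, ψ z * b 1 z i, fun i => ∑ w, φ w * c' w i]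
  let y : Fin 3 → Fin 4 → ℂ := ![fun j => ∑ w, φ w * b' 0 w j, fun j => ∑ w, φ w * b' 1 w j, fun j => ∑ z, ψ z * c z j]
  have hR' : ∀ i j, (!![0, κ * (φ 2 * φ 3), φ 1 * φ 3, φ 1 * φ 2; κ * (φ 2 * φ 3), 0, μ * (φ 0 * φ 3), μ * (φ 0 * φ 2);
      φ 1 * φ 3, μ * (φ 0 * φ 3), 0, 0; φ 1 * φ 2, μ * (φ 0 * φ 2), 0, 0] : Matrix (Fin 4) (Fin 4) ℂ) i j =
      ∑ k : Fin 3, x k i * y k j := by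
    intro i j
    have := congrFun (congrFun hR i) j
    rw [this]
    simp [x, y, vecMulVec_apply, Fin.sum_univ_three]
  obtain ⟨hy, hx⟩ := orth_of_test_vector φ hφ κ μ hκ hμ x y hR'
  refine ⟨fun k => ?_, ?_, fun k => ?_, ?_⟩
  · fin_cases k
    · exact hy 0
    · exact hy 1
  · exact hy 2
  · fin_cases k
    · exact hx 0
    · exact hx 1
  · exact hx 2

/-- **The S9 lemma.**  If `g_t ∈ span{E^{01}, A_{23}}` (`t = 0, 1`), then for each of `b_k, b′_k, c, c′`, column `2` is
`τ e₃` and column `3` is `τ e₂` with the same `τ`. -/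
theorem columns23_of_EA (g h b b' : Fin 2 → Fin 4 → Fin 4 → ℂ) (c c' : Fin 4 → Fin 4 → ℂ)
    (hsum : ∀ v, permPattern₄ v = (∑ t, g t (v 0) (v 1) * h t (v 2) (v 3)) +
      (∑ k, b k (v 0) (v 2) * b' k (v 1) (v 3)) + c (v 0) (v 3) * c' (v 1) (v 2))
    (hg : ∀ t, (g t 2 2 = 0 ∧ g t 3 3 = 0 ∧ g t 2 3 + g t 3 2 = 0 ∧ ∀ j, j ≠ 2 → j ≠ 3 → g t 2 j = 0 ∧ g t 3 j = 0) ∧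
      (g t 0 0 = 0 ∧ g t 1 1 = 0 ∧ g t 0 1 = g t 1 0 ∧ ∀ j, j ≠ 0 → j ≠ 1 → g t 0 j = 0 ∧ g t 1 j = 0)) :
    (∀ k, b k 0 2 = 0 ∧ b k 1 2 = 0 ∧ b k 2 2 = 0 ∧ b k 0 3 = 0 ∧ b k 1 3 = 0 ∧ b k 3 3 = 0 ∧ b k 3 2 = b k 2 3) ∧
    (∀ k, b' k 0 2 = 0 ∧ b' k 1 2 = 0 ∧ b' k 2 2 = 0 ∧ b' k 0 3 = 0 ∧ b' k 1 3 = 0 ∧ b' k 3 3 = 0 ∧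
      b' k 3 2 = b' k 2 3) ∧
    (c 0 2 = 0 ∧ c 1 2 = 0 ∧ c 2 2 = 0 ∧ c 0 3 = 0 ∧ c 1 3 = 0 ∧ c 3 3 = 0 ∧ c 3 2 = c 2 3) ∧
    (c' 0 2 = 0 ∧ c' 1 2 = 0 ∧ c' 2 2 = 0 ∧ c' 0 3 = 0 ∧ c' 1 3 = 0 ∧ c' 3 3 = 0 ∧ c' 3 2 = c' 2 3) := by
  -- the two test vectors lie in the kernel of the noise forms
  have kerA : ∀ (φ : Fin 4 → ℂ) (t : Fin 2), (∑ i, ∑ j, (![0, 0, φ 2, φ 3] : Fin 4 → ℂ) i * φ j * g t i j) = 0 := by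
    intro φ t
    obtain ⟨⟨g22, g33, g23s, hr23⟩, ⟨-, -, -, -⟩⟩ := hg t
    obtain ⟨g20, g30⟩ := hr23 0 (by decide) (by decide)
    obtain ⟨g21, g31⟩ := hr23 1 (by decide) (by decide)
    simp only [Fin.sum_univ_four, Matrix.cons_val_zero, Matrix.cons_val_one, Matrix.head_cons, Matrix.cons_val_two,
      Matrix.tail_cons, Matrix.cons_val_three, g20, g21, g22, g30, g31, g33]
    linear_combination φ 2 * φ 3 * g23s
  have kerB : ∀ (φ : Fin 4 → ℂ) (t : Fin 2),
      (∑ i, ∑ j, (![φ 0, -φ 1, 2 * φ 2, 2 * φ 3] : Fin 4 → ℂ) i * φ j * g t i j) = 0 := by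
    intro φ t
    obtain ⟨⟨g22, g33, g23s, hr23⟩, ⟨g00, g11, g01s, hr01⟩⟩ := hg t
    obtain ⟨g20, g30⟩ := hr23 0 (by decide) (by decide)
    obtain ⟨g21, g31⟩ := hr23 1 (by decide) (by decide)
    obtain ⟨g02, g12⟩ := hr01 2 (by decide) (by decide)
    obtain ⟨g03, g13⟩ := hr01 3 (by decide) (by decide)
    simp only [Fin.sum_univ_four, Matrix.cons_val_zero, Matrix.cons_val_one, Matrix.head_cons, Matrix.cons_val_two,
      Matrix.tail_cons, Matrix.cons_val_three, g20, g21, g22, g30, g31, g33, g00, g11, g02, g12, g03, g13]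
    linear_combination 2 * φ 2 * φ 3 * g23s + φ 0 * φ 1 * g01s
  have runA : ∀ φ : Fin 4 → ℂ, (∀ i, φ i ≠ 0) → _ := fun φ hφ =>
    orth_run g h b b' c c' hsum φ ![0, 0, φ 2, φ 3] hφ 2 1 two_ne_zero one_ne_zero
      (by rw [Q_psiA]; simp) (kerA φ)
  have runB : ∀ φ : Fin 4 → ℂ, (∀ i, φ i ≠ 0) → _ := fun φ hφ =>
    orth_run g h b b' c c' hsum φ ![φ 0, -φ 1, 2 * φ 2, 2 * φ 3] hφ 4 3 (by norm_num) (by norm_num)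
      (Q_psiB φ) (kerB φ)
  refine ⟨fun k => ?_, fun k => ?_, ?_, ?_⟩
  · refine cols_of_psi_identity (b k) (fun φ hφ => ?_) (fun φ hφ => ?_)
    · have := (runA φ hφ).2.2.1 k
      simp only [Fin.sum_univ_four, Matrix.cons_val_zero, Matrix.cons_val_one, Matrix.head_cons, Matrix.cons_val_two,
        Matrix.tail_cons, Matrix.cons_val_three] at this
      linear_combination this
    · have := (runB φ hφ).2.2.1 k
      simp only [Fin.sum_univ_four, Matrix.cons_val_zero, Matrix.cons_val_one, Matrix.head_cons, Matrix.cons_val_two,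
        Matrix.tail_cons, Matrix.cons_val_three] at this
      linear_combination this
  · exact cols_of_phi_identity (b' k) (fun φ hφ => (runA φ hφ).1 k)
  · refine cols_of_psi_identity c (fun φ hφ => ?_) (fun φ hφ => ?_)
    · have := (runA φ hφ).2.1
      simp only [Fin.sum_univ_four, Matrix.cons_val_zero, Matrix.cons_val_one, Matrix.head_cons, Matrix.cons_val_two,
        Matrix.tail_cons, Matrix.cons_val_three] at this
      linear_combination this
    · have := (runB φ hφ).2.1
      simp only [Fin.sum_univ_four, Matrix.cons_val_zero, Matrix.cons_val_one, Matrix.head_cons, Matrix.cons_val_two,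
        Matrix.tail_cons, Matrix.cons_val_three] at this
      linear_combination this
  · exact cols_of_phi_identity c' (fun φ hφ => (runA φ hφ).2.2.2)

end LaplaceFourLine

end Summit.ValiantsHypothesis.ValiantsHypothesis.Theorems.RigidityForcesSymmetryRankRigidMinimalRepr
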